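import Summits.QuantumFields.BalabanUV.T4Continuum.Support.ShellMeasureDecayKernelBinders

/-!
# `T4Continuum.ShellMeasureDecayKernelTail` — WALL §2 (a) item (P4), row S66 file 3c: p. 289's `𝔇₂` REMARK IN THE
# KERNEL.  The derivative KERNEL of a map on bond fields, `dker D A c b := π_c ∘ DD(A) ∘ ι_b` (B11's `𝔇(A′; c, b) =
# (δ∕δA′(b))D(A′, c)`, (63)–(64) TYPE), recomposes to `DD(A)` (`kerOp_dker`); the derivative kernel of the ORDER-≥3
# PART `ord₃ D` is the ENTRYWISE 2-tail of `dker D` (`dker_ord₃_eq_tail₂`); hence an entrywise bound `‖dker D A c b‖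
# ≤ μ c b` on `ball 0 R` — a DECAY DISPLAY — passes to `ord₃ D` with the SAME decay factor and the prefactor
# `4‖A‖²∕R²` («(73) with ε₃² instead of ε₃»); so file 2b's `hM₃'` and the capstone of file 3b need NO separate kernel
# hypothesis for `D₃` (cell `pub-balaban`, sub-cell `t4`, spine estimate NE7c (node U5b); NE7c ROUND-2 crew, unit
# `b2b-balaban-t4-ne7c-formalise-leaf-06` gen 4, owner table `LEAVES-NE7c-P1.md` row S66 f3; imports file 3b
# `ShellMeasureDecayKernelBinders` ONLY (hence 3a, the owner's 2a∕2b and S62 f1∕f3); [folklore]; three DATA defs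
# (`dker`, the vector-valued `jet₂`∕`ord₃`), 0 `def … : Prop`, 0 sorry)

HONEST FRAMING.  Finite four-torus programme, rung (B)+1 only — NOT infinite volume, NOT a mass gap, NOT the Clay
problem, NOT summit progress; (B), `BetaPertHyp`, (B^μ) are not consumed.  NE7c (`T4IndicatorShell.ShellWeightBound`)
is NOT PRINTED and NOT PROVED; «NE7c ⇐ the named binders».  ELEMENTARY calculus on OUR side; nothing printed is
asserted.  [Balaban1985Variational] (cell paper B11) p. 289, the remark after Proposition 3 (lineage transcript
`HOME/b2b-balaban-b11/transcript.md` l. 71): *«The operator 𝔇(A′) is an analytic function in A′, and its expansion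
begins with a linear term in A′, coming from the differentiation of D⁽²⁾(A′) = C⁽²⁾(A′). If we subtract these terms
from 𝔇(A′), then we get an operator 𝔇₂(A′) for which we have the bound (73) with ε₃² instead of ε₃.»*, and (63)–(64),
(73) — LOCATORS for the SHAPES only; (73) itself stays a DISPLAYED binder (crew seat leaf-08 derives its shape from
(69)∕(72)-TYPE inputs in `ShellMeasureLandauDerivativeDecay`).  HONEST DEPENDENCY (cell): continuum YM on T⁴ ⇐ BetaPertH
∧ nine spine estimates (0/9 proved); BetaPertH ⇐ (D1) ∧ (D4) ∧ CAP+tail; G-an2-4 gates asym, D1 and NE2/3/4.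

CONTENT.
* §1 `dker D A c b := π_c ∘L DD(A) ∘L ι_b` (DATA) and **`kerOp_dker`**: `kerOp (dker D A) = fderiv ℂ D A` for EVERY
  map and point (nothing is lost) — so the `hker` hypotheses of file 3b are discharged by taking `kD := dker D`, and a
  (73)-TYPE display is LITERALLY a bound on `dker D`.
* §2 the vector-valued 2-jet `jet₂ D A := D 0 + DD(0)A + ½·D²D(0)(A, A)` and order-≥3 part `ord₃ D := D − jet₂ D`
  (DATA; the owner's S62 f3 `ShellMeasureLocalGradientTailJet.jet₂`∕`ord₃` are the scalar case), `hasFDerivAt_ord₃`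
  (`D(ord₃ D)(A) = DD(A) − DD(0) − D²D(0)(A, ·)`, symmetry of `D²D(0)` by `ContDiffAt.isSymmSndFDerivAt` over ℂ),
  `analyticOnNhd_ord₃`.
* §3 **`dker_ord₃_eq_tail₂`**: for `D` analytic on `ball 0 R` and `A` in the ball,
  `dker (ord₃ D) A c b = tail₂ (fun A => dker D A c b) A` (S62 f1's `tail₂`) — `𝔇₂` IS the entrywise 2-tail of `𝔇`.
* §4 THE REMARK: **`norm_dker_ord₃_le`** — `‖dker D A c b‖ ≤ μ c b` on `ball 0 R` ⟹ `‖dker (ord₃ D) A c b‖ ≤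
  (4·μ c b∕R²)·‖A‖²` there (S62 f1 `norm_tail₂_le` per entry): the decay factor of `μ` survives, the prefactor squares;
  `colSum_dker_ord₃_le_torus`: on `(ℤ∕Tℤ)ᵈ`, `‖dker D A c b‖ ≤ c₀·e^{−δ·pl1(pos c − pos b)}` on the ball ⟹ column
  sums of `dker (ord₃ D) A` `≤ (4c₀∕R²)·(m′·K₁ d δ)·‖A‖²` — file 2b's `hM₃'` currency, volume-free.
* §5 **`prop4Hyp_termsHD_of_decay_torus'`** — file 3b's capstone with `M₃ := kerOp hH ∘ ord₃ D` and the three `D₃`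
  hypotheses (`hD₃a`, `hker₃`, `hkD₃`) GONE: ONE (73)-TYPE display for `dker D` (pointwise form `c₀‖A‖e^{−δ·pl1}`),
  one (46)-TYPE and one (3.132)-TYPE layer ⟹ file 2b's `prop4Hyp_locGrad_termsHD`, constant = 2b's polynomial at
  `m₀ = m₁ = Hc·Dc`, `k₀ = k₁ = Pc·Hc·Dc`, `c₃ = Hc·D₃c` with `D₃c ≥ (4c₀∕r)·(m·K₁ d δ)`.
NOT HERE: (73)∕(46)∕(3.132) themselves (DISPLAYED); the identification of `D`, `H`, `Δ_π` with Bałaban's sectioned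
objects ([dict]); the multi-scale weights (row S65).  No estimate of Bałaban's is discharged; NOTHING in the countdown
moves.
-/

noncomputable section

open Metric Set Filter
open scoped Topology

namespace Summit.QuantumFields.BalabanUV.T4Continuum.ShellMeasureDecayKernelTail

open Literature.MathematicalPhysics.QuantumFieldTheory.Balaban1983to89
open B11Prop6Scheme (Prop4Hyp)
open B12Decay510Window (K₁)
open TreeLengthTorus (TPt)
open B12Decay510Torus (pl1)
open ShellMeasureLocalGradientTail (tail₂ sgl sgl_apply locGrad norm_tail₂_le)
open ShellMeasureGradientTailPairing (norm₁)
open ShellMeasureGradientTailHDLocal (termsHD prop4Hyp_locGrad_termsHD)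
open ShellMeasureDecayKernelSums (kerOp kerOp_apply kerOp_single compKer rowSum_compKer_le colSum_compKer_le
  rowSum_le_of_decay_torus colSum_le_of_decay_torus)
open ShellMeasureDecayKernelBinders (analyticOnNhd_kerOp_comp row_binder_kerOp_of_kernel col_binder_kerOp_of_kernel)

variable {E F : Type*} [NormedAddCommGroup E] [NormedSpace ℂ E] [NormedAddCommGroup F] [NormedSpace ℂ F]
variable {Λ Λ' : Type*} [Fintype Λ] [Fintype Λ'] [DecidableEq Λ] [DecidableEq Λ']
variable {𝔄 𝔅 : Type*} [NormedAddCommGroup 𝔄] [NormedSpace ℂ 𝔄] [NormedAddCommGroup 𝔅] [NormedSpace ℂ 𝔅]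

/-! ## §1 The derivative kernel `𝔇(A′; c, b)` of a map on bond fields, and its recomposition -/

/-- THE DERIVATIVE KERNEL of `D : (Λ → 𝔄) → (Λ′ → 𝔅)` at `A`: `dker D A c b := π_c ∘ DD(A) ∘ ι_b ∈ (𝔄 →L 𝔅)` — the
(63)–(64) TYPE `𝔇(A′; c, b) = (δ∕δA′(b)) D(A′, c)` (DATA; locator only). [folklore] -/
def dker (D : (Λ → 𝔄) → (Λ' → 𝔅)) (A : Λ → 𝔄) (c : Λ') (b : Λ) : 𝔄 →L[ℂ] 𝔅 :=
  (ContinuousLinearMap.proj c).comp ((fderiv ℂ D A).comp (sgl b))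

omit [Fintype Λ'] [DecidableEq Λ'] in
/-- `dker D A c b X = (DD(A)(ι_b X)) c`. [folklore] -/
@[simp] theorem dker_apply (D : (Λ → 𝔄) → (Λ' → 𝔅)) (A : Λ → 𝔄) (c : Λ') (b : Λ) (X : 𝔄) :
    dker D A c b X = fderiv ℂ D A (Pi.single b X) c := rfl

omit [Fintype Λ'] [DecidableEq Λ'] in
/-- **NOTHING IS LOST**: `kerOp (dker D A) = DD(A)` for every map and every point (`h = Σ_b ι_b (h b)`), so file 3b's
`hker` hypotheses hold with `kD := dker D` and a (73)-TYPE display is literally a bound on `dker D`. [folklore] -/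
theorem kerOp_dker (D : (Λ → 𝔄) → (Λ' → 𝔅)) (A : Λ → 𝔄) : kerOp (dker D A) = fderiv ℂ D A := by
  ext h c
  rw [kerOp_apply]
  simp only [dker_apply]
  rw [← Finset.sum_apply, ← map_sum, Finset.univ_sum_single h]

omit [DecidableEq Λ'] in
/-- The entries are differentiable where `DD` is. [folklore] -/
theorem differentiableOn_dker {D : (Λ → 𝔄) → (Λ' → 𝔅)} {s : Set (Λ → 𝔄)}
    (hD : DifferentiableOn ℂ (fderiv ℂ D) s) (c : Λ') (b : Λ) :
    DifferentiableOn ℂ (fun A => dker D A c b) s :=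
  (differentiableOn_const _).clm_comp (hD.clm_comp (differentiableOn_const _))

/-! ## §2 The vector-valued 2-jet and order-≥3 part -/

/-- The 2-JET of a vector-valued map at the origin: `D 0 + DD(0)A + ½·D²D(0)(A, A)` (DATA; the scalar case is the
owner's `ShellMeasureLocalGradientTailJet.jet₂`). [folklore] -/
def jet₂ (D : E → F) (A : E) : F := D 0 + fderiv ℂ D 0 A + (2 : ℂ)⁻¹ • fderiv ℂ (fderiv ℂ D) 0 A A

/-- THE ORDER-≥3 PART `ord₃ D := D − jet₂ D` (DATA) — for the Landau correction `D` this is the `D₃` of (80), whose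
derivative kernel is p. 289's `𝔇₂` (locator only). [folklore] -/
def ord₃ (D : E → F) (A : E) : F := D A - jet₂ D A

/-- Unfolding. [folklore] -/
theorem ord₃_apply (D : E → F) (A : E) :
    ord₃ D A = D A - D 0 - fderiv ℂ D 0 A - (2 : ℂ)⁻¹ • fderiv ℂ (fderiv ℂ D) 0 A A := by
  simp only [ord₃, jet₂]
  abel

/-- The derivative of the quadratic form `A ↦ f''(A, A)`: `h ↦ f''(A, h) + f''(h, A)`. [folklore] -/
theorem hasFDerivAt_quadForm (f'' : E →L[ℂ] E →L[ℂ] F) (A : E) :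
    HasFDerivAt (fun A => f'' A A) (f'' A + f''.flip A) A := by
  have h := (f''.hasFDerivAt (x := A)).clm_apply (hasFDerivAt_id A)
  have he : (f'' A).comp (ContinuousLinearMap.id ℂ E) + f''.flip (id A) = f'' A + f''.flip A := by
    ext h
    simp
  rw [he] at h
  exact h

/-- `D²D(0)` is symmetric for `D` analytic near `0` (`ContDiffAt.isSymmSndFDerivAt` over ℂ). [folklore] -/
theorem fderiv_fderiv_symm [CompleteSpace F] {D : E → F} (hD : AnalyticAt ℂ D 0) (v w : E) :
    fderiv ℂ (fderiv ℂ D) 0 v w = fderiv ℂ (fderiv ℂ D) 0 w v :=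
  (hD.contDiffAt (n := ⊤)).isSymmSndFDerivAt (by simp) v w

/-- Hence the derivative of `A ↦ ½·D²D(0)(A, A)` at `A` is `D²D(0)(A, ·)`. [folklore] -/
theorem hasFDerivAt_half_quadForm [CompleteSpace F] {D : E → F} (hD : AnalyticAt ℂ D 0) (A : E) :
    HasFDerivAt (fun A => (2 : ℂ)⁻¹ • fderiv ℂ (fderiv ℂ D) 0 A A) (fderiv ℂ (fderiv ℂ D) 0 A) A := by
  have h := (hasFDerivAt_quadForm (fderiv ℂ (fderiv ℂ D) 0) A).const_smul (2 : ℂ)⁻¹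
  have he : (2 : ℂ)⁻¹ • (fderiv ℂ (fderiv ℂ D) 0 A + (fderiv ℂ (fderiv ℂ D) 0).flip A) =
      fderiv ℂ (fderiv ℂ D) 0 A := by
    ext h
    change (2 : ℂ)⁻¹ • (fderiv ℂ (fderiv ℂ D) 0 A h + fderiv ℂ (fderiv ℂ D) 0 h A) = fderiv ℂ (fderiv ℂ D) 0 A h
    rw [fderiv_fderiv_symm hD h A, ← two_smul ℂ (fderiv ℂ (fderiv ℂ D) 0 A h), smul_smul]
    norm_num
  rw [he] at h
  exact h

/-- The derivative of `ord₃ D` at a point `A` where `D` is differentiable (and analytic at `0`):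
`D(ord₃ D)(A) = DD(A) − DD(0) − D²D(0)(A, ·)`. [folklore] -/
theorem hasFDerivAt_ord₃ [CompleteSpace F] {D : E → F} (hD0 : AnalyticAt ℂ D 0) {A : E}
    (hDA : DifferentiableAt ℂ D A) :
    HasFDerivAt (ord₃ D) (fderiv ℂ D A - fderiv ℂ D 0 - fderiv ℂ (fderiv ℂ D) 0 A) A := by
  have h1 : HasFDerivAt (fun A => D A - D 0 - fderiv ℂ D 0 A) (fderiv ℂ D A - fderiv ℂ D 0) A :=
    (hDA.hasFDerivAt.sub_const (D 0)).sub ((fderiv ℂ D 0).hasFDerivAt (x := A))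
  have h2 := h1.sub (hasFDerivAt_half_quadForm hD0 A)
  refine h2.congr_of_eventuallyEq (Eventually.of_forall fun A' => ?_)
  simp only [Pi.sub_apply, ord₃_apply]

/-- `ord₃ D` is analytic where `D` is (on a ball about `0`). [folklore] -/
theorem analyticOnNhd_ord₃ {D : E → F} {R : ℝ} (hR : 0 < R) (hD : AnalyticOnNhd ℂ D (ball 0 R)) :
    AnalyticOnNhd ℂ (ord₃ D) (ball 0 R) := by
  intro A hA
  have h0 : AnalyticAt ℂ D 0 := hD 0 (mem_ball_self hR)
  have hq : AnalyticAt ℂ (fun A : E => fderiv ℂ (fderiv ℂ D) 0 A A) A :=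
    ((fderiv ℂ (fderiv ℂ D) 0).analyticAt_bilinear (A, A)).comp_of_eq (analyticAt_id.prod analyticAt_id) rfl
  have h : AnalyticAt ℂ (fun A => D A - D 0 - fderiv ℂ D 0 A - (2 : ℂ)⁻¹ • fderiv ℂ (fderiv ℂ D) 0 A A) A :=
    (((hD A hA).sub analyticAt_const).sub ((fderiv ℂ D 0).analyticAt A)).sub (analyticAt_const.smul hq)
  refine h.congr (Eventually.of_forall fun A' => ?_)
  exact (ord₃_apply D A').symm

/-! ## §3 `𝔇₂` IS THE ENTRYWISE 2-TAIL OF `𝔇` -/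

section Tail

variable [CompleteSpace 𝔅]

omit [DecidableEq Λ'] in
/-- The derivative at `0` of the `(c, b)` entry `A ↦ dker D A c b`, applied to `A′`, is `π_c ∘ D²D(0)(A′, ·) ∘ ι_b`
(for `D` analytic on a ball about `0`). [folklore] -/
theorem fderiv_dker_entry_zero {D : (Λ → 𝔄) → (Λ' → 𝔅)} {R : ℝ} (hR : 0 < R) (hD : AnalyticOnNhd ℂ D (ball 0 R))
    (c : Λ') (b : Λ) (A' : Λ → 𝔄) :
    fderiv ℂ (fun A => dker D A c b) 0 A' =
      (ContinuousLinearMap.proj c).comp ((fderiv ℂ (fderiv ℂ D) 0 A').comp (sgl b)) := by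
  have hc : HasFDerivAt (fderiv ℂ D) (fderiv ℂ (fderiv ℂ D) 0) 0 :=
    ((hD 0 (mem_ball_self hR)).fderiv.differentiableAt).hasFDerivAt
  have h := (hasFDerivAt_const (ContinuousLinearMap.proj (R := ℂ) (φ := fun _ : Λ' => 𝔅) c) (0 : Λ → 𝔄)).clm_comp
    (hc.clm_comp (hasFDerivAt_const (sgl b : 𝔄 →L[ℂ] (Λ → 𝔄)) (0 : Λ → 𝔄)))
  simp only [dker]
  rw [h.fderiv]
  ext X
  simp

omit [DecidableEq Λ'] in
/-- **THE DICTIONARY**: for `D` analytic on `ball 0 R` and `A` in the ball,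
`dker (ord₃ D) A c b = tail₂ (fun A => dker D A c b) A` — p. 289's `𝔇₂(A′)` (the derivative kernel of the order-≥3
part) IS the entrywise 2-tail of `𝔇(A′)` (locator only). [folklore] -/
theorem dker_ord₃_eq_tail₂ {D : (Λ → 𝔄) → (Λ' → 𝔅)} {R : ℝ} (hR : 0 < R) (hD : AnalyticOnNhd ℂ D (ball 0 R))
    {A : Λ → 𝔄} (hA : A ∈ ball (0 : Λ → 𝔄) R) (c : Λ') (b : Λ) :
    dker (ord₃ D) A c b = tail₂ (fun A => dker D A c b) A := by
  have hD0 : AnalyticAt ℂ D 0 := hD 0 (mem_ball_self hR)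
  have hDA : DifferentiableAt ℂ D A := (hD A hA).differentiableAt
  rw [show tail₂ (fun A => dker D A c b) A = dker D A c b - dker D 0 c b - fderiv ℂ (fun A => dker D A c b) 0 A
      from rfl, fderiv_dker_entry_zero hR hD c b A]
  simp only [dker, (hasFDerivAt_ord₃ hD0 hDA).fderiv, ContinuousLinearMap.comp_sub, ContinuousLinearMap.sub_comp]

/-! ## §4 The remark: the entrywise 2-tail keeps the decay and squares the prefactor -/

omit [DecidableEq Λ'] in
/-- **«(73) WITH ε₃² INSTEAD OF ε₃»**: `D` analytic on `ball 0 R` with the entrywise display `‖dker D A c b‖ ≤ μ c b`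
there ⟹ `‖dker (ord₃ D) A c b‖ ≤ (4·μ c b∕R²)·‖A‖²` on the ball — the DECAY FACTOR carried by `μ` survives entry by
entry; the prefactor becomes `4‖A‖²∕R²` (S62 f1 `norm_tail₂_le` applied to each entry). [folklore] -/
theorem norm_dker_ord₃_le {D : (Λ → 𝔄) → (Λ' → 𝔅)} {R : ℝ} (hR : 0 < R) (hD : AnalyticOnNhd ℂ D (ball 0 R))
    (μ : Λ' → Λ → ℝ) (hμ : ∀ A ∈ ball (0 : Λ → 𝔄) R, ∀ c b, ‖dker D A c b‖ ≤ μ c b)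
    {A : Λ → 𝔄} (hA : A ∈ ball (0 : Λ → 𝔄) R) (c : Λ') (b : Λ) :
    ‖dker (ord₃ D) A c b‖ ≤ 4 * μ c b / R ^ 2 * ‖A‖ ^ 2 := by
  rw [dker_ord₃_eq_tail₂ hR hD hA c b]
  exact norm_tail₂_le hR (differentiableOn_dker hD.fderiv.differentiableOn c b) (fun A hA => hμ A hA c b) A hA

omit [DecidableEq Λ'] in
/-- … hence COLUMN sums: `Σ_c ‖dker (ord₃ D) A c b‖ ≤ (4∕R²)·(Σ_c μ c b)·‖A‖²` (and rows alike). [folklore] -/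
theorem colSum_dker_ord₃_le {D : (Λ → 𝔄) → (Λ' → 𝔅)} {R : ℝ} (hR : 0 < R) (hD : AnalyticOnNhd ℂ D (ball 0 R))
    (μ : Λ' → Λ → ℝ) (hμ : ∀ A ∈ ball (0 : Λ → 𝔄) R, ∀ c b, ‖dker D A c b‖ ≤ μ c b)
    {A : Λ → 𝔄} (hA : A ∈ ball (0 : Λ → 𝔄) R) (b : Λ) :
    ∑ c, ‖dker (ord₃ D) A c b‖ ≤ 4 / R ^ 2 * (∑ c, μ c b) * ‖A‖ ^ 2 := by
  calc ∑ c, ‖dker (ord₃ D) A c b‖ ≤ ∑ c, 4 * μ c b / R ^ 2 * ‖A‖ ^ 2 :=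
        Finset.sum_le_sum fun c _ => norm_dker_ord₃_le hR hD μ hμ hA c b
    _ = 4 / R ^ 2 * (∑ c, μ c b) * ‖A‖ ^ 2 := by
        rw [Finset.mul_sum, Finset.sum_mul]
        exact Finset.sum_congr rfl fun c _ => by ring

omit [DecidableEq Λ'] in
/-- **ON THE TORUS, VOLUME-FREE** (file 2b's `hM₃'` currency): `‖dker D A c b‖ ≤ c₀·e^{−δ·pl1(pos′ c − pos b)}` on
`ball 0 R` (the (73)-TYPE display AT RADIUS `R`), at most `m′` output indices per site ⟹
`Σ_c ‖dker (ord₃ D) A c b‖ ≤ (4c₀∕R²)·(m′·K₁ d δ)·‖A‖²` on the ball. [folklore] -/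
theorem colSum_dker_ord₃_le_torus {d T : ℕ} [NeZero T] (posIn : Λ → TPt d T) (posOut : Λ' → TPt d T)
    {D : (Λ → 𝔄) → (Λ' → 𝔅)} {R c₀ δ : ℝ} (hR : 0 < R) (hc₀ : 0 ≤ c₀) (hδ : 0 < δ)
    (hD : AnalyticOnNhd ℂ D (ball 0 R)) {m' : ℕ} (hm' : ∀ x, (Finset.univ.filter fun c => posOut c = x).card ≤ m')
    (hk : ∀ A ∈ ball (0 : Λ → 𝔄) R, ∀ c b, ‖dker D A c b‖ ≤ c₀ * Real.exp (-(δ * pl1 (posOut c - posIn b))))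
    {A : Λ → 𝔄} (hA : A ∈ ball (0 : Λ → 𝔄) R) (b : Λ) :
    ∑ c, ‖dker (ord₃ D) A c b‖ ≤ 4 * c₀ / R ^ 2 * (m' * K₁ d δ) * ‖A‖ ^ 2 := by
  -- the tail kernel `dker (ord₃ D) A` is dominated by `(4c₀‖A‖²∕R²)·e^{−δ·pl1}` entrywise
  have htail : ∀ c b', ‖dker (ord₃ D) A c b'‖ ≤
      4 * c₀ / R ^ 2 * ‖A‖ ^ 2 * Real.exp (-(δ * pl1 (posOut c - posIn b'))) := fun c b' => by
    have h := norm_dker_ord₃_le hR hD (fun c b => c₀ * Real.exp (-(δ * pl1 (posOut c - posIn b)))) hk hA c b'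
    calc _ ≤ 4 * (c₀ * Real.exp (-(δ * pl1 (posOut c - posIn b')))) / R ^ 2 * ‖A‖ ^ 2 := h
      _ = 4 * c₀ / R ^ 2 * ‖A‖ ^ 2 * Real.exp (-(δ * pl1 (posOut c - posIn b'))) := by ring
  have h := colSum_le_of_decay_torus (dker (ord₃ D) A) posIn posOut (by positivity) hδ hm' htail b
  calc _ ≤ 4 * c₀ / R ^ 2 * ‖A‖ ^ 2 * (m' * K₁ d δ) := h
    _ = 4 * c₀ / R ^ 2 * (m' * K₁ d δ) * ‖A‖ ^ 2 := by ring

end Tail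

/-! ## §5 File 3b's capstone with NO separate hypothesis for `D₃` -/

/-- **DECAY DISPLAYS ⇒ THE (98) SHAPE OF (80)'s HD-TERMS, `M₃` FROM THE SAME (73) DISPLAY.**  As
`ShellMeasureDecayKernelBinders.prop4Hyp_termsHD_of_decay_torus`, but with `M₃ := kerOp hH ∘ ord₃ D` and the three `D₃`
hypotheses REMOVED: the ONE (73)-TYPE display for `dker D` (pointwise form `‖dker D A c b‖ ≤ c₀‖A‖e^{−δ·pl1(pos c −
pos b)}` on `ball 0 r`, hence `≤ c₀r·e^{…}` there), a (46)-TYPE layer `hH` and a (3.132)-TYPE layer `hP` give file 2b's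
`prop4Hyp_locGrad_termsHD` for `M = kerOp hH ∘ D`, `M₃ = kerOp hH ∘ ord₃ D`, `K = kerOp (compKer hP hH) ∘ D`, constant
= 2b's polynomial at `m₀ = m₁ = Hc·Dc`, `k₀ = k₁ = Pc·Hc·Dc`, `c₃ = Hc·D₃c`, where now `D₃c ≥ (4c₀∕r)·(m·K₁ d δ)` (§4).
Still DISPLAYED: (73)∕(46)∕(3.132), `j₀`, the plaquette part's `C₀`, [dict]. [folklore] -/
theorem prop4Hyp_termsHD_of_decay_torus' [CompleteSpace 𝔄] {d T : ℕ} [NeZero T] (pos : Λ → TPt d T) {m : ℕ}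
    (hm : ∀ x, (Finset.univ.filter fun b => pos b = x).card ≤ m) (π : 𝔄 →L[ℂ] 𝔄 →L[ℂ] ℂ) (J : Λ → 𝔄)
    (V₀ : (Λ → 𝔄) → ℂ) {D : (Λ → 𝔄) → (Λ → 𝔄)} {r R₀ C₀ j₀ c₀ δ h₀ δH p₀ δP Hc Pc Dc D₃c : ℝ}
    (hr : 0 < r) (hr1 : r ≤ 1) (hrR₀ : 2 * r ≤ R₀) (hC₀ : 0 ≤ C₀) (hJ : ‖J‖ ≤ j₀) (hc₀ : 0 ≤ c₀) (hδ : 0 < δ)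
    (hh₀ : 0 ≤ h₀) (hδH : 0 < δH) (hp₀ : 0 ≤ p₀) (hδP : 0 < δP)
    (hDa : AnalyticOnNhd ℂ D (ball 0 r)) (hD0 : D 0 = 0)
    (hkD : ∀ A ∈ ball (0 : Λ → 𝔄) r, ∀ c b, ‖dker D A c b‖ ≤ c₀ * ‖A‖ * Real.exp (-(δ * pl1 (pos c - pos b))))
    (hH : Λ → Λ → (𝔄 →L[ℂ] 𝔄)) (hhH : ∀ e c, ‖hH e c‖ ≤ h₀ * Real.exp (-(δH * pl1 (pos e - pos c))))
    (hP : Λ → Λ → (𝔄 →L[ℂ] 𝔄)) (hhP : ∀ e c, ‖hP e c‖ ≤ p₀ * Real.exp (-(δP * pl1 (pos e - pos c))))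
    (hV₀a : AnalyticOnNhd ℂ V₀ (ball 0 R₀)) (hV₀g : ∀ y ∈ ball (0 : Λ → 𝔄) R₀, ‖locGrad V₀ y‖ ≤ C₀ * ‖y‖ ^ 2)
    (hHc : h₀ * (m * K₁ d δH) ≤ Hc) (hPc : p₀ * (m * K₁ d δP) ≤ Pc) (hDc : c₀ * (m * K₁ d δ) ≤ Dc)
    (hD₃c : 4 * c₀ / r * (m * K₁ d δ) ≤ D₃c) (hsmall : Hc * Dc * r ≤ 1) :
    Prop4Hyp (locGrad (termsHD π J (fun A => kerOp hH (D A)) (fun A => kerOp hH (ord₃ D A))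
        (fun A => kerOp (compKer hP hH) (D A)) V₀))
      (‖π‖ * (j₀ * (Hc * D₃c) + Pc * Hc * Dc + Pc * Hc * Dc + (Hc * Dc * (Pc * Hc * Dc) + Hc * Dc * (Pc * Hc * Dc)) / 2)
        + 4 * C₀ * (1 + Hc * Dc)) r := by
  have hK₁ : ∀ a : ℝ, 0 ≤ (m : ℝ) * K₁ d a := fun a => mul_nonneg (Nat.cast_nonneg m) (B12Decay510Window.K₁_nonneg d a)
  have hHc0 : 0 ≤ Hc := (mul_nonneg hh₀ (hK₁ δH)).trans hHc
  have hPc0 : 0 ≤ Pc := (mul_nonneg hp₀ (hK₁ δP)).trans hPc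
  have hDc0 : 0 ≤ Dc := (mul_nonneg hc₀ (hK₁ δ)).trans hDc
  have hD₃c0 : 0 ≤ D₃c := (mul_nonneg (by positivity) (hK₁ δ)).trans hD₃c
  -- the (73)-type display: pointwise rows∕columns `≤ Dc‖A‖`, and the uniform bound `c₀ r` on the ball for the tail
  have hDrow : ∀ A ∈ ball (0 : Λ → 𝔄) r, ∀ c, ∑ b, ‖dker D A c b‖ ≤ Dc * ‖A‖ := fun A hA c =>
    (rowSum_le_of_decay_torus (dker D A) pos pos (mul_nonneg hc₀ (norm_nonneg A)) hδ hm (hkD A hA) c).trans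
      (by nlinarith [mul_le_mul_of_nonneg_right hDc (norm_nonneg A)])
  have hDcol : ∀ A ∈ ball (0 : Λ → 𝔄) r, ∀ b, ∑ c, ‖dker D A c b‖ ≤ Dc * ‖A‖ := fun A hA b =>
    (colSum_le_of_decay_torus (dker D A) pos pos (mul_nonneg hc₀ (norm_nonneg A)) hδ hm (hkD A hA) b).trans
      (by nlinarith [mul_le_mul_of_nonneg_right hDc (norm_nonneg A)])
  have hkR : ∀ A ∈ ball (0 : Λ → 𝔄) r, ∀ c b, ‖dker D A c b‖ ≤ c₀ * r * Real.exp (-(δ * pl1 (pos c - pos b))) :=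
    fun A hA c b => (hkD A hA c b).trans (by
      have ha : ‖A‖ ≤ r := (mem_ball_zero_iff.1 hA).le
      have he := (Real.exp_pos (-(δ * pl1 (pos c - pos b)))).le
      nlinarith [mul_le_mul_of_nonneg_left ha hc₀])
  have hD₃col : ∀ A ∈ ball (0 : Λ → 𝔄) r, ∀ b, ∑ c, ‖dker (ord₃ D) A c b‖ ≤ D₃c * ‖A‖ ^ 2 := fun A hA b => by
    have h := colSum_dker_ord₃_le_torus pos pos hr (mul_nonneg hc₀ hr.le) hδ hDa hm hkR hA b
    have e : 4 * (c₀ * r) / r ^ 2 * (m * K₁ d δ) = 4 * c₀ / r * (m * K₁ d δ) := by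
      field_simp
    rw [e] at h
    exact h.trans (mul_le_mul_of_nonneg_right hD₃c (sq_nonneg _))
  have hHrow : ∀ e, ∑ c, ‖hH e c‖ ≤ Hc := fun e => (rowSum_le_of_decay_torus hH pos pos hh₀ hδH hm hhH e).trans hHc
  have hHcol : ∀ c, ∑ e, ‖hH e c‖ ≤ Hc := fun c => (colSum_le_of_decay_torus hH pos pos hh₀ hδH hm hhH c).trans hHc
  have hProw : ∀ e, ∑ c, ‖hP e c‖ ≤ Pc := fun e => (rowSum_le_of_decay_torus hP pos pos hp₀ hδP hm hhP e).trans hPc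
  have hPcol : ∀ c, ∑ e, ‖hP e c‖ ≤ Pc := fun c => (colSum_le_of_decay_torus hP pos pos hp₀ hδP hm hhP c).trans hPc
  have hKrow : ∀ e, ∑ b, ‖compKer hP hH e b‖ ≤ Pc * Hc := rowSum_compKer_le hP hH hHc0 hProw hHrow
  have hKcol : ∀ b, ∑ e, ‖compKer hP hH e b‖ ≤ Pc * Hc := colSum_compKer_le hP hH hPc0 hPcol hHcol
  have hDd : DifferentiableOn ℂ D (ball 0 r) := hDa.differentiableOn
  have hD₃a : AnalyticOnNhd ℂ (ord₃ D) (ball 0 r) := analyticOnNhd_ord₃ hr hDa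
  have hker : ∀ A ∈ ball (0 : Λ → 𝔄) r, fderiv ℂ D A = kerOp (dker D A) := fun A _ => (kerOp_dker D A).symm
  have hker₃ : ∀ A ∈ ball (0 : Λ → 𝔄) r, fderiv ℂ (ord₃ D) A = kerOp (dker (ord₃ D) A) := fun A _ =>
    (kerOp_dker (ord₃ D) A).symm
  refine prop4Hyp_locGrad_termsHD hr hr1 hrR₀ (mul_nonneg hHc0 hDc0) (mul_nonneg hHc0 hDc0)
    (mul_nonneg (mul_nonneg hPc0 hHc0) hDc0) (mul_nonneg (mul_nonneg hPc0 hHc0) hDc0) (mul_nonneg hHc0 hD₃c0) hC₀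
    hsmall hJ (analyticOnNhd_kerOp_comp hH hDa) (analyticOnNhd_kerOp_comp hH hD₃a)
    (analyticOnNhd_kerOp_comp (compKer hP hH) hDa) hV₀a
    (row_binder_kerOp_of_kernel hDc0 hDd hD0 (dker D) hker hDrow hH hHc0 hHrow)
    (row_binder_kerOp_of_kernel hDc0 hDd hD0 (dker D) hker hDrow (compKer hP hH) (mul_nonneg hPc0 hHc0) hKrow)
    (fun A hA b X => ?_) (fun A hA b X => ?_) (fun A hA b X => ?_) hV₀g
  · have h := col_binder_kerOp_of_kernel hDd (dker D) hker (fun A => Dc * ‖A‖) hDcol hH hHc0 hHcol A hA b X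
    calc _ ≤ Hc * (Dc * ‖A‖) * ‖X‖ := h
      _ = Hc * Dc * ‖A‖ * ‖X‖ := by ring
  · have h := col_binder_kerOp_of_kernel hDd (dker D) hker (fun A => Dc * ‖A‖) hDcol (compKer hP hH)
      (mul_nonneg hPc0 hHc0) hKcol A hA b X
    calc _ ≤ Pc * Hc * (Dc * ‖A‖) * ‖X‖ := h
      _ = Pc * Hc * Dc * ‖A‖ * ‖X‖ := by ring
  · have h := col_binder_kerOp_of_kernel hD₃a.differentiableOn (dker (ord₃ D)) hker₃ (fun A => D₃c * ‖A‖ ^ 2) hD₃col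
      hH hHc0 hHcol A hA b X
    calc _ ≤ Hc * (D₃c * ‖A‖ ^ 2) * ‖X‖ := h
      _ = Hc * D₃c * ‖A‖ ^ 2 * ‖X‖ := by ring

end Summit.QuantumFields.BalabanUV.T4Continuum.ShellMeasureDecayKernelTail

end
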